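import Literature.NumberTheory.EllipticCurves.Fisher2012.HesseFamilyThreeCongruenceProofs
import Summits.BirchSwinnertonDyer.Rank1Residual.X1.CongruenceTransfer
import Summits.BirchSwinnertonDyer.Rank1Residual.Additive.IntModelTamagawaCertificate
import HarnessLib

/-!
# The C-VIS `θ/hθ` column of the T-VIS3-REC row shapes as KERNEL THEOREMS: `E′[3] ≅ E[3]`
# (`Γ_ℚ`-equivariant) for the seven batch-1 pairs, from ONE rational point of Fisher's `n = 3` Hesse
# pencil — five UNCONDITIONAL, two modulo the registered dual-pencil fact
# (cell `b2b-bsdres`, team n1011, ROW T-VIS3-TH FILE 1; seat p07 (gen 10); skeleton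
# cells/n1011/skel/T-VIS3-TH.md; "θ via KO/Fisher = p07 / r2 lane", p18 GEN 8, r2 ROUTE-2 ST-31.3)

HONEST FRAMING (cell `b2b-bsdres`, run/shared/lean/b2b/bsd-rank1-residual/, verbatim in every
file): the goal of the cell is to DELETE the COMBINATION-SHAPED residual classes of the
Birch–Swinnerton-Dyer formula for ALL analytic-rank `≤ 1` elliptic curves over `ℚ` — "full BSD
formula for every rank `≤ 1` curve in class `C`" assembled STRICTLY from published theorems — so
that the rank-`≤ 1` remainder becomes exactly the CONSTRUCTION-SHAPED classes, which are TYPED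
(missing-input `Prop`s), NOT attempted. This is not "finishing BSD". Team n1011 (N11 = X4 ∧ `p = 3`):
research route; RECORD theorems only — NO definition (the fourteen curves enter as LITERAL
equations under hypotheses `hW : W = ⟨…⟩`, p18's binder style), NO new named fact, NO `sorry`;
closes nothing by itself; nothing booked; no mark / label / count moved.

## What

p18's T-VIS3-REC row shapes `Additive/X4ThreeVisibleRowShape<L>.lean` (`bsdp3_vis_v<L>`: `BSD(E,3)`
for an X4 rank-0 row `E` from a `3`-congruent rank-2 partner `E′`, every local binder in the kernel;
lead GEN 8 R5-82 (d)) display the congruence as the binder pair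
`(θ : geomTorsion W' ((3:ℕ):ℤ) ≃+ geomTorsion W ((3:ℕ):ℤ)) (hθ : ∀ σ P, θ (σ • P) = σ • θ P)` =
`X1.CongruenceTransfer.TorsionIso W' W 3` unpacked — "EVIDENCE until a named fact + certificate".
The named fact IS a tree THEOREM for the direct family: Fisher, Proc. LMS 104 (2012) Thm. 13.2
(`n = 3`) = `Fisher2012.thm132_threeCongruent_hessePencil_holds` (n1011-p02, T-F132-3), with the
certificate corollary `Fisher2012.threeCongruent_of_hesseCertificate_unconditional (W G) (l m u)`:
`𝔠₄(l,m) = u⁴·c₄(G) ∧ 𝔠₆(l,m) = u⁶·c₆(G) ⟹ ∃ e : G[3] ≃ W[3]` equivariant. With base `W := E` and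
member `G := E′` this is p18's `(θ, hθ)` (orientation `E′ → E`). So each pair below costs TWO
`norm_num` identities — no Kraus–Oesterlé prime list, no Sturm bound, no `a_ℓ` table:

| row `E` | partner `E′` | family | `(l : m)` | `u` | `θ` |
|---|---|---|---|---|---|
| 7704q1 | 7704r1 | direct | `(−544719 : 2)` | `243` | unconditional |
| 15129e1 | 15129d1 | dual only | `(−5658 : 1)` | `1/246` | mod `thm132rev…` |
| 17208i1 | 17208k1 | direct | `(−23478 : 1)` | `54` | unconditional |
| 13248bm1 | 13248bn1 | direct | `(−312 : 1)` | `24` | unconditional |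
| 19575h1 | 2175c1 | direct | `(−705105 : 11)` | `1687500` | unconditional |
| 19575j1 | 2175c1 | direct | `(0 : 1)` | `540` | unconditional |
| 19809d1 | 59427a1 | dual only | `(−2618 : 19)` | `1/18` | mod `thm132rev…` |

The two DUAL-only pairs (the direct `j`-equation has no rational root from either base; complete
root finding mod `1009`) are anti-symplectic `3`-congruences: they carry the registered fact
`thm132rev_threeCongruent_dualHessePencil` (Fisher 2012 §13, the `X_E^-(3)` analogue of Thm. 13.2)
as the displayed hypothesis `hF'` until n1011-p02's ROW T-F132-3R discharges it. Per pair: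
`torsionIso3_<E′>_<E> (hW) (hW') : TorsionIso W' W 3` and the form
`torsionIso3_<E′>_<E>_of_integralModelInt (hI : integralModelInt W = …) (W') (hW')` in the EXACT
binder currency of `bsdp3_vis_v<E>` (`W` globally minimal), so that
`obtain ⟨θ, hθ⟩ := …` feeds the row shape verbatim (ROW T-VIS3-TH FILE 2).

Witness search: n1011-r2 GEN 25's `cells/n1011/route2/g25/tvis3_hesse3_search.py` (stdlib, exact
arithmetic) as a library verbatim; 3 of the 7 pairs are in r2's `TVIS3-H3-certs-g25.tsv` and agree;
driver and output `HOME/b2b-bsdres-n1011-p07/g10/tools/certs_batch1.{py,out}`. The witnesses are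
inputs only — the kernel re-verifies both identities. Closes nothing: a row shape with `θ/hθ`
discharged still displays {named facts, `hr`, `hq/hv` (`#Ш_an`), `hrank` (+ `D/hc`)}.

References: T. Fisher, *The Hessian of a genus one curve*, Proc. LMS 104 (2012) 613–648, Thm. 13.2,
§8, §13 [Fisher2012Hessian]; K. Rubin, A. Silverberg, *Families of elliptic curves with constant
mod p representations* (1995); J. Cremona, B. Mazur, *Visualizing elements in the Shafarevich–Tate
group*, Exp. Math. 9 (2000) [CremonaMazur2000]; [Cremona2006] (labels); cells/n1011/ROUTE-1.md §40–41
(r1), ROUTE-2.md II.31 ST-31.3 (r2), skel/T-VIS3-TH.md.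
-/

set_option autoImplicit false

open MvPolynomial WeierstrassCurve
open Literature.NumberTheory.EllipticCurves Literature.NumberTheory.EllipticCurves.Fisher2012
open Summit.BirchSwinnertonDyer.Rank1Residual.X1.CongruenceTransfer
  Summit.BirchSwinnertonDyer.BirchSwinnertonDyer.Rank1Residual.IntModel
  Summit.BirchSwinnertonDyer.Rank1Residual.Additive

namespace Summit.BirchSwinnertonDyer.Rank1Residual.GaloisImage.VisCerts

/-- **C-VIS certificate `7704r1 ~ 7704q1` at `p = 3`, DIRECT (`X_E(3)`, Fisher 2012 Thm. 13.2, n = 3;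
UNCONDITIONAL by `threeCongruent_of_hesseCertificate_unconditional`):** for the N11 row `E = 7704q1
= [0, 0, 0, -1545392343, -23383324023721]` (`c₄ = 74178832464`, `c₆ = 20203191956494944`) and its
rank-2 partner `E′ = 7704r1 = [0, 0, 0, -183, 911]` (`c₄ = 8784`, `c₆ = -787104`), the rational
point `(l : m) = (-544719 : 2)` of the Hesse pencil of `E` with `u = 243` lands on `E′` — two
`norm_num` identities; hence `TorsionIso W' W 3` (`Γ_ℚ`-iso `E′[3] ≅ E[3]`, orientation `E′ → E` =
p18's `(θ, hθ)`). (M) row; r2 g25 table ✓. Closes nothing; nothing booked.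
[cite: Fisher2012Hessian, Thm. 13.2 (n = 3)] -/
theorem torsionIso3_7704r1_7704q1 (W W' : WeierstrassCurve ℚ) [W.IsElliptic] [W'.IsElliptic]
    (hW : W = ⟨0, 0, 0, -1545392343, -23383324023721⟩) (hW' : W' = ⟨0, 0, 0, -183, 911⟩) :
    TorsionIso W' W 3 := by
  have h4 : W.c₄ = 74178832464 := by
    subst hW; norm_num [WeierstrassCurve.c₄, WeierstrassCurve.b₂, WeierstrassCurve.b₄]
  have h6 : W.c₆ = 20203191956494944 := by
    subst hW
    norm_num [WeierstrassCurve.c₆, WeierstrassCurve.b₂, WeierstrassCurve.b₄, WeierstrassCurve.b₆]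
  have h4' : W'.c₄ = 8784 := by
    subst hW'; norm_num [WeierstrassCurve.c₄, WeierstrassCurve.b₂, WeierstrassCurve.b₄]
  have h6' : W'.c₆ = -787104 := by
    subst hW'
    norm_num [WeierstrassCurve.c₆, WeierstrassCurve.b₂, WeierstrassCurve.b₄, WeierstrassCurve.b₆]
  exact threeCongruent_of_hesseCertificate_unconditional W W' (-544719) 2 243 (by norm_num)
    (by rw [eval_hesseC4three, h4, h6, h4']; norm_num)
    (by rw [eval_hesseC6three, h4, h6, h6']; norm_num)

/-- The same certificate in the EXACT binder currency of p18's row shape `bsdp3_vis_v7704q1`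
(`hI : integralModelInt W = …`, `W` globally minimal; `hW' : W' = …`): `TorsionIso W' W 3`, so
`obtain ⟨θ, hθ⟩ := torsionIso3_7704r1_7704q1_of_integralModelInt …` feeds the shape verbatim.
[folklore] -/
theorem torsionIso3_7704r1_7704q1_of_integralModelInt (W : WeierstrassCurve ℚ) [W.IsElliptic]
    [W.IsGloballyMinimal]
    (hI : integralModelInt W = ⟨0, 0, 0, -1545392343, -23383324023721⟩)
    (W' : WeierstrassCurve ℚ) (hW' : W' = ⟨0, 0, 0, -183, 911⟩) [W'.IsElliptic] :
    TorsionIso W' W 3 :=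
  torsionIso3_7704r1_7704q1 W W'
    (by rw [IntModelTam.eq_baseChange_of_integralModelInt hI]
        exact IntModelTam.baseChange_rat_mk_int _ _ _ _ _) hW'

/-- **C-VIS certificate `15129d1 ~ 15129e1` at `p = 3`, DUAL (`X_E^-(3)`, Fisher 2012 §13; modulo the
registered fact `thm132rev_threeCongruent_dualHessePencil`, displayed as `hF'`):** for the N11 row
`E = 15129e1 = [0, 0, 1, -156333, -25414619]` (`c₄ = 7503984`, `c₆ = 21958230600`) and its rank-2
partner `E′ = 15129d1 = [1, -1, 1, -131, 600]` (`c₄ = 6273`, `c₆ = -490401`), the rational point `(l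
: m) = (-5658 : 1)` of the dual Hesse pencil of `E` with `u = 1/246` lands on `E′` — two `norm_num`
identities; hence `TorsionIso W' W 3` (`Γ_ℚ`-iso `E′[3] ≅ E[3]`, orientation `E′ → E` = p18's `(θ,
hθ)`). (M) row; outside g28_V40. Closes nothing; nothing booked.
[cite: Fisher2012Hessian, §13 (analogue of Thm. 13.2 for X_E^-(3))] -/
theorem torsionIso3_15129d1_15129e1 (hF' : thm132rev_threeCongruent_dualHessePencil)
    (W W' : WeierstrassCurve ℚ) [W.IsElliptic] [W'.IsElliptic]
    (hW : W = ⟨0, 0, 1, -156333, -25414619⟩) (hW' : W' = ⟨1, -1, 1, -131, 600⟩) :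
    TorsionIso W' W 3 := by
  have h4 : W.c₄ = 7503984 := by
    subst hW; norm_num [WeierstrassCurve.c₄, WeierstrassCurve.b₂, WeierstrassCurve.b₄]
  have h6 : W.c₆ = 21958230600 := by
    subst hW
    norm_num [WeierstrassCurve.c₆, WeierstrassCurve.b₂, WeierstrassCurve.b₄, WeierstrassCurve.b₆]
  have h4' : W'.c₄ = 6273 := by
    subst hW'; norm_num [WeierstrassCurve.c₄, WeierstrassCurve.b₂, WeierstrassCurve.b₄]
  have h6' : W'.c₆ = -490401 := by
    subst hW'
    norm_num [WeierstrassCurve.c₆, WeierstrassCurve.b₂, WeierstrassCurve.b₄, WeierstrassCurve.b₆]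
  exact threeCongruent_of_dualHesseCertificate hF' W W' (-5658) 1 (1 / 246 : ℚ) (by norm_num)
    (by rw [eval_hesseD3, h4, h6, h4']; norm_num)
    (by rw [eval_hesseC6three, h4, h6, h6']; norm_num)

/-- The same certificate in the EXACT binder currency of p18's row shape `bsdp3_vis_v15129e1`
(`hI : integralModelInt W = …`, `W` globally minimal; `hW' : W' = …`): `TorsionIso W' W 3`, so
`obtain ⟨θ, hθ⟩ := torsionIso3_15129d1_15129e1_of_integralModelInt …` feeds the shape verbatim.
[folklore] -/
theorem torsionIso3_15129d1_15129e1_of_integralModelInt (hF' : thm132rev_threeCongruent_dualHessePencil)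
    (W : WeierstrassCurve ℚ) [W.IsElliptic]
    [W.IsGloballyMinimal]
    (hI : integralModelInt W = ⟨0, 0, 1, -156333, -25414619⟩)
    (W' : WeierstrassCurve ℚ) (hW' : W' = ⟨1, -1, 1, -131, 600⟩) [W'.IsElliptic] :
    TorsionIso W' W 3 :=
  torsionIso3_15129d1_15129e1 hF' W W'
    (by rw [IntModelTam.eq_baseChange_of_integralModelInt hI]
        exact IntModelTam.baseChange_rat_mk_int _ _ _ _ _) hW'

/-- **C-VIS certificate `17208k1 ~ 17208i1` at `p = 3`, DIRECT (`X_E(3)`, Fisher 2012 Thm. 13.2, n = 3;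
UNCONDITIONAL by `threeCongruent_of_hesseCertificate_unconditional`):** for the N11 row `E = 17208i1
= [0, 0, 0, -11485911, -14982913897]` (`c₄ = 551323728`, `c₆ = 12945237607008`) and its rank-2
partner `E′ = 17208k1 = [0, 0, 0, -579, 5411]` (`c₄ = 27792`, `c₆ = -4675104`), the rational point
`(l : m) = (-23478 : 1)` of the Hesse pencil of `E` with `u = 54` lands on `E′` — two `norm_num`
identities; hence `TorsionIso W' W 3` (`Γ_ℚ`-iso `E′[3] ≅ E[3]`, orientation `E′ → E` = p18's `(θ,
hθ)`). (M) row; outside g28_V40. Closes nothing; nothing booked.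
[cite: Fisher2012Hessian, Thm. 13.2 (n = 3)] -/
theorem torsionIso3_17208k1_17208i1 (W W' : WeierstrassCurve ℚ) [W.IsElliptic] [W'.IsElliptic]
    (hW : W = ⟨0, 0, 0, -11485911, -14982913897⟩) (hW' : W' = ⟨0, 0, 0, -579, 5411⟩) :
    TorsionIso W' W 3 := by
  have h4 : W.c₄ = 551323728 := by
    subst hW; norm_num [WeierstrassCurve.c₄, WeierstrassCurve.b₂, WeierstrassCurve.b₄]
  have h6 : W.c₆ = 12945237607008 := by
    subst hW
    norm_num [WeierstrassCurve.c₆, WeierstrassCurve.b₂, WeierstrassCurve.b₄, WeierstrassCurve.b₆]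
  have h4' : W'.c₄ = 27792 := by
    subst hW'; norm_num [WeierstrassCurve.c₄, WeierstrassCurve.b₂, WeierstrassCurve.b₄]
  have h6' : W'.c₆ = -4675104 := by
    subst hW'
    norm_num [WeierstrassCurve.c₆, WeierstrassCurve.b₂, WeierstrassCurve.b₄, WeierstrassCurve.b₆]
  exact threeCongruent_of_hesseCertificate_unconditional W W' (-23478) 1 54 (by norm_num)
    (by rw [eval_hesseC4three, h4, h6, h4']; norm_num)
    (by rw [eval_hesseC6three, h4, h6, h6']; norm_num)

/-- The same certificate in the EXACT binder currency of p18's row shape `bsdp3_vis_v17208i1`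
(`hI : integralModelInt W = …`, `W` globally minimal; `hW' : W' = …`): `TorsionIso W' W 3`, so
`obtain ⟨θ, hθ⟩ := torsionIso3_17208k1_17208i1_of_integralModelInt …` feeds the shape verbatim.
[folklore] -/
theorem torsionIso3_17208k1_17208i1_of_integralModelInt (W : WeierstrassCurve ℚ) [W.IsElliptic]
    [W.IsGloballyMinimal]
    (hI : integralModelInt W = ⟨0, 0, 0, -11485911, -14982913897⟩)
    (W' : WeierstrassCurve ℚ) (hW' : W' = ⟨0, 0, 0, -579, 5411⟩) [W'.IsElliptic] :
    TorsionIso W' W 3 :=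
  torsionIso3_17208k1_17208i1 W W'
    (by rw [IntModelTam.eq_baseChange_of_integralModelInt hI]
        exact IntModelTam.baseChange_rat_mk_int _ _ _ _ _) hW'

/-- **C-VIS certificate `13248bn1 ~ 13248bm1` at `p = 3`, DIRECT (`X_E(3)`, Fisher 2012 Thm. 13.2, n =
3; UNCONDITIONAL by `threeCongruent_of_hesseCertificate_unconditional`):** for the N11 row `E =
13248bm1 = [0, 0, 0, -1980, -33912]` (`c₄ = 95040`, `c₆ = 29299968`) and its rank-2 partner `E′ =
13248bn1 = [0, 0, 0, 180, 1296]` (`c₄ = -8640`, `c₆ = -1119744`), the rational point `(l : m) =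
(-312 : 1)` of the Hesse pencil of `E` with `u = 24` lands on `E′` — two `norm_num` identities;
hence `TorsionIso W' W 3` (`Γ_ℚ`-iso `E′[3] ≅ E[3]`, orientation `E′ → E` = p18's `(θ, hθ)`). (G)
row; outside g28_V40. Closes nothing; nothing booked.
[cite: Fisher2012Hessian, Thm. 13.2 (n = 3)] -/
theorem torsionIso3_13248bn1_13248bm1 (W W' : WeierstrassCurve ℚ) [W.IsElliptic] [W'.IsElliptic]
    (hW : W = ⟨0, 0, 0, -1980, -33912⟩) (hW' : W' = ⟨0, 0, 0, 180, 1296⟩) :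
    TorsionIso W' W 3 := by
  have h4 : W.c₄ = 95040 := by
    subst hW; norm_num [WeierstrassCurve.c₄, WeierstrassCurve.b₂, WeierstrassCurve.b₄]
  have h6 : W.c₆ = 29299968 := by
    subst hW
    norm_num [WeierstrassCurve.c₆, WeierstrassCurve.b₂, WeierstrassCurve.b₄, WeierstrassCurve.b₆]
  have h4' : W'.c₄ = -8640 := by
    subst hW'; norm_num [WeierstrassCurve.c₄, WeierstrassCurve.b₂, WeierstrassCurve.b₄]
  have h6' : W'.c₆ = -1119744 := by
    subst hW'
    norm_num [WeierstrassCurve.c₆, WeierstrassCurve.b₂, WeierstrassCurve.b₄, WeierstrassCurve.b₆]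
  exact threeCongruent_of_hesseCertificate_unconditional W W' (-312) 1 24 (by norm_num)
    (by rw [eval_hesseC4three, h4, h6, h4']; norm_num)
    (by rw [eval_hesseC6three, h4, h6, h6']; norm_num)

/-- The same certificate in the EXACT binder currency of p18's row shape `bsdp3_vis_v13248bm1`
(`hI : integralModelInt W = …`, `W` globally minimal; `hW' : W' = …`): `TorsionIso W' W 3`, so
`obtain ⟨θ, hθ⟩ := torsionIso3_13248bn1_13248bm1_of_integralModelInt …` feeds the shape verbatim.
[folklore] -/
theorem torsionIso3_13248bn1_13248bm1_of_integralModelInt (W : WeierstrassCurve ℚ) [W.IsElliptic]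
    [W.IsGloballyMinimal]
    (hI : integralModelInt W = ⟨0, 0, 0, -1980, -33912⟩)
    (W' : WeierstrassCurve ℚ) (hW' : W' = ⟨0, 0, 0, 180, 1296⟩) [W'.IsElliptic] :
    TorsionIso W' W 3 :=
  torsionIso3_13248bn1_13248bm1 W W'
    (by rw [IntModelTam.eq_baseChange_of_integralModelInt hI]
        exact IntModelTam.baseChange_rat_mk_int _ _ _ _ _) hW'

/-- **C-VIS certificate `2175c1 ~ 19575h1` at `p = 3`, DIRECT (`X_E(3)`, Fisher 2012 Thm. 13.2, n = 3;
UNCONDITIONAL by `threeCongruent_of_hesseCertificate_unconditional`):** for the N11 row `E = 19575h1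
= [1, -1, 1, -72378605, -236930312978]` (`c₄ = 3474173025`, `c₆ = 204723424191375`) and its rank-2
partner `E′ = 2175c1 = [1, 1, 1, -688, 6656]` (`c₄ = 33025`, `c₆ = -5998625`), the rational point
`(l : m) = (-705105 : 11)` of the Hesse pencil of `E` with `u = 1687500` lands on `E′` — two
`norm_num` identities; hence `TorsionIso W' W 3` (`Γ_ℚ`-iso `E′[3] ≅ E[3]`, orientation `E′ → E` =
p18's `(θ, hθ)`). (G) row; r2 g25 table ✓. Closes nothing; nothing booked.
[cite: Fisher2012Hessian, Thm. 13.2 (n = 3)] -/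
theorem torsionIso3_2175c1_19575h1 (W W' : WeierstrassCurve ℚ) [W.IsElliptic] [W'.IsElliptic]
    (hW : W = ⟨1, -1, 1, -72378605, -236930312978⟩) (hW' : W' = ⟨1, 1, 1, -688, 6656⟩) :
    TorsionIso W' W 3 := by
  have h4 : W.c₄ = 3474173025 := by
    subst hW; norm_num [WeierstrassCurve.c₄, WeierstrassCurve.b₂, WeierstrassCurve.b₄]
  have h6 : W.c₆ = 204723424191375 := by
    subst hW
    norm_num [WeierstrassCurve.c₆, WeierstrassCurve.b₂, WeierstrassCurve.b₄, WeierstrassCurve.b₆]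
  have h4' : W'.c₄ = 33025 := by
    subst hW'; norm_num [WeierstrassCurve.c₄, WeierstrassCurve.b₂, WeierstrassCurve.b₄]
  have h6' : W'.c₆ = -5998625 := by
    subst hW'
    norm_num [WeierstrassCurve.c₆, WeierstrassCurve.b₂, WeierstrassCurve.b₄, WeierstrassCurve.b₆]
  exact threeCongruent_of_hesseCertificate_unconditional W W' (-705105) 11 1687500 (by norm_num)
    (by rw [eval_hesseC4three, h4, h6, h4']; norm_num)
    (by rw [eval_hesseC6three, h4, h6, h6']; norm_num)

/-- The same certificate in the EXACT binder currency of p18's row shape `bsdp3_vis_v19575h1`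
(`hI : integralModelInt W = …`, `W` globally minimal; `hW' : W' = …`): `TorsionIso W' W 3`, so
`obtain ⟨θ, hθ⟩ := torsionIso3_2175c1_19575h1_of_integralModelInt …` feeds the shape verbatim.
[folklore] -/
theorem torsionIso3_2175c1_19575h1_of_integralModelInt (W : WeierstrassCurve ℚ) [W.IsElliptic]
    [W.IsGloballyMinimal]
    (hI : integralModelInt W = ⟨1, -1, 1, -72378605, -236930312978⟩)
    (W' : WeierstrassCurve ℚ) (hW' : W' = ⟨1, 1, 1, -688, 6656⟩) [W'.IsElliptic] :
    TorsionIso W' W 3 :=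
  torsionIso3_2175c1_19575h1 W W'
    (by rw [IntModelTam.eq_baseChange_of_integralModelInt hI]
        exact IntModelTam.baseChange_rat_mk_int _ _ _ _ _) hW'

/-- **C-VIS certificate `2175c1 ~ 19575j1` at `p = 3`, DIRECT (`X_E(3)`, Fisher 2012 Thm. 13.2, n = 3;
UNCONDITIONAL by `threeCongruent_of_hesseCertificate_unconditional`):** for the N11 row `E = 19575j1
= [0, 0, 1, -675, -31219]` (`c₄ = 32400`, `c₆ = 26973000`) and its rank-2 partner `E′ = 2175c1 = [1,
1, 1, -688, 6656]` (`c₄ = 33025`, `c₆ = -5998625`), the rational point `(l : m) = (0 : 1)` of the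
Hesse pencil of `E` with `u = 540` lands on `E′` — two `norm_num` identities; hence `TorsionIso W' W
3` (`Γ_ℚ`-iso `E′[3] ≅ E[3]`, orientation `E′ → E` = p18's `(θ, hθ)`). (G) row; r2 g25 table ✓.
Closes nothing; nothing booked.
[cite: Fisher2012Hessian, Thm. 13.2 (n = 3)] -/
theorem torsionIso3_2175c1_19575j1 (W W' : WeierstrassCurve ℚ) [W.IsElliptic] [W'.IsElliptic]
    (hW : W = ⟨0, 0, 1, -675, -31219⟩) (hW' : W' = ⟨1, 1, 1, -688, 6656⟩) :
    TorsionIso W' W 3 := by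
  have h4 : W.c₄ = 32400 := by
    subst hW; norm_num [WeierstrassCurve.c₄, WeierstrassCurve.b₂, WeierstrassCurve.b₄]
  have h6 : W.c₆ = 26973000 := by
    subst hW
    norm_num [WeierstrassCurve.c₆, WeierstrassCurve.b₂, WeierstrassCurve.b₄, WeierstrassCurve.b₆]
  have h4' : W'.c₄ = 33025 := by
    subst hW'; norm_num [WeierstrassCurve.c₄, WeierstrassCurve.b₂, WeierstrassCurve.b₄]
  have h6' : W'.c₆ = -5998625 := by
    subst hW'
    norm_num [WeierstrassCurve.c₆, WeierstrassCurve.b₂, WeierstrassCurve.b₄, WeierstrassCurve.b₆]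
  exact threeCongruent_of_hesseCertificate_unconditional W W' (0) 1 540 (by norm_num)
    (by rw [eval_hesseC4three, h4, h6, h4']; norm_num)
    (by rw [eval_hesseC6three, h4, h6, h6']; norm_num)

/-- The same certificate in the EXACT binder currency of p18's row shape `bsdp3_vis_v19575j1`
(`hI : integralModelInt W = …`, `W` globally minimal; `hW' : W' = …`): `TorsionIso W' W 3`, so
`obtain ⟨θ, hθ⟩ := torsionIso3_2175c1_19575j1_of_integralModelInt …` feeds the shape verbatim.
[folklore] -/
theorem torsionIso3_2175c1_19575j1_of_integralModelInt (W : WeierstrassCurve ℚ) [W.IsElliptic]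
    [W.IsGloballyMinimal]
    (hI : integralModelInt W = ⟨0, 0, 1, -675, -31219⟩)
    (W' : WeierstrassCurve ℚ) (hW' : W' = ⟨1, 1, 1, -688, 6656⟩) [W'.IsElliptic] :
    TorsionIso W' W 3 :=
  torsionIso3_2175c1_19575j1 W W'
    (by rw [IntModelTam.eq_baseChange_of_integralModelInt hI]
        exact IntModelTam.baseChange_rat_mk_int _ _ _ _ _) hW'

/-- **C-VIS certificate `59427a1 ~ 19809d1` at `p = 3`, DUAL (`X_E^-(3)`, Fisher 2012 §13; modulo the
registered fact `thm132rev_threeCongruent_dualHessePencil`, displayed as `hF'`):** for the N11 row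
`E = 19809d1 = [0, 0, 1, -393, -2999]` (`c₄ = 18864`, `c₆ = 2590920`) and its rank-2 partner `E′ =
59427a1 = [1, -1, 1, -15191, -710550]` (`c₄ = 729153`, `c₆ = 617196159`), the rational point `(l :
m) = (-2618 : 19)` of the dual Hesse pencil of `E` with `u = 1/18` lands on `E′` — two `norm_num`
identities; hence `TorsionIso W' W 3` (`Γ_ℚ`-iso `E′[3] ≅ E[3]`, orientation `E′ → E` = p18's `(θ,
hθ)`). (G) row; outside g28_V40. Closes nothing; nothing booked.
[cite: Fisher2012Hessian, §13 (analogue of Thm. 13.2 for X_E^-(3))] -/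
theorem torsionIso3_59427a1_19809d1 (hF' : thm132rev_threeCongruent_dualHessePencil)
    (W W' : WeierstrassCurve ℚ) [W.IsElliptic] [W'.IsElliptic]
    (hW : W = ⟨0, 0, 1, -393, -2999⟩) (hW' : W' = ⟨1, -1, 1, -15191, -710550⟩) :
    TorsionIso W' W 3 := by
  have h4 : W.c₄ = 18864 := by
    subst hW; norm_num [WeierstrassCurve.c₄, WeierstrassCurve.b₂, WeierstrassCurve.b₄]
  have h6 : W.c₆ = 2590920 := by
    subst hW
    norm_num [WeierstrassCurve.c₆, WeierstrassCurve.b₂, WeierstrassCurve.b₄, WeierstrassCurve.b₆]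
  have h4' : W'.c₄ = 729153 := by
    subst hW'; norm_num [WeierstrassCurve.c₄, WeierstrassCurve.b₂, WeierstrassCurve.b₄]
  have h6' : W'.c₆ = 617196159 := by
    subst hW'
    norm_num [WeierstrassCurve.c₆, WeierstrassCurve.b₂, WeierstrassCurve.b₄, WeierstrassCurve.b₆]
  exact threeCongruent_of_dualHesseCertificate hF' W W' (-2618) 19 (1 / 18 : ℚ) (by norm_num)
    (by rw [eval_hesseD3, h4, h6, h4']; norm_num)
    (by rw [eval_hesseC6three, h4, h6, h6']; norm_num)

/-- The same certificate in the EXACT binder currency of p18's row shape `bsdp3_vis_v19809d1`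
(`hI : integralModelInt W = …`, `W` globally minimal; `hW' : W' = …`): `TorsionIso W' W 3`, so
`obtain ⟨θ, hθ⟩ := torsionIso3_59427a1_19809d1_of_integralModelInt …` feeds the shape verbatim.
[folklore] -/
theorem torsionIso3_59427a1_19809d1_of_integralModelInt (hF' : thm132rev_threeCongruent_dualHessePencil)
    (W : WeierstrassCurve ℚ) [W.IsElliptic]
    [W.IsGloballyMinimal]
    (hI : integralModelInt W = ⟨0, 0, 1, -393, -2999⟩)
    (W' : WeierstrassCurve ℚ) (hW' : W' = ⟨1, -1, 1, -15191, -710550⟩) [W'.IsElliptic] :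
    TorsionIso W' W 3 :=
  torsionIso3_59427a1_19809d1 hF' W W'
    (by rw [IntModelTam.eq_baseChange_of_integralModelInt hI]
        exact IntModelTam.baseChange_rat_mk_int _ _ _ _ _) hW'

end Summit.BirchSwinnertonDyer.Rank1Residual.GaloisImage.VisCerts
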